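import Mathlib
import HarnessLib
import Summits.HubbardSuperconductivity.HubbardSuperconductivity.Theorems.KLProgrammeKLRegimeEngineLastStepResponseBracketFlowFinalGraded
import Summits.HubbardSuperconductivity.HubbardSuperconductivity.Theorems.KLProgrammeKLRegimeFlowReadPrivSwapLit

/-!
# K3 gen-8-FLOW (stmt 20437, stub (C), located item #20, cure (δ′) «LAST-STEP SWAP», layer F3k′): THE LAST-INDEX TWO-LEG READING FROM THE GRADED DOOR —
# `twoLegRead_flow_last_registered_of_door_graded` = k3c3-p1's (P)-receiver `twoLegRead_flow_succ_of_swap_lit_registered` at `n := n_β` with its (R) bracket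
# `(hRdiff, hR)` SUPPLIED by `lastResponse_bracket_flow_final_graded` (located «(C)-S-ROW-GRADING», cell gate-hubbard-kl, seat p2 g21)

Verbatim twin of `twoLegRead_flow_last_registered_of_door` (p638087) over the GRADED door: the two order-`s` envelopes read `hNsb : Msb ≤ Nsb·((4:ℝ)^{n_β})^s`,
`hNsc : Msc ≤ Nsc·((4:ℝ)^{n_β})^s` and the smallness row `hCU` carries `Ns_X/2^282` (was `Ns_X/2^217`); everything else byte-identical.  WHAT REMAINS for the last
index after this file (by name): the door's inputs (regime, engine history, `hL : klEngL₄ ≤ L`, `hZn`, the two U-rows, the four moments + GRADED envelopes + `hZb/hZc`),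
the volume guard `4·klFlowDeg(n_β+1) ≤ L`, and the closer-side brackets (A) `hA/hAval`, (T) `hTr/hTrdiff`, (C1) `hJ/hJdiff` with `eT 0 = eJ 0 = 0` and the three fits.

* **`twoLegRead_flow_last_registered_of_door_graded`**.

Composition only; no definitions; nothing asserts superconductivity.  Refs: BGM 2006 §2.4 Lemma 2.1 (2.36)–(2.42) [cite: BenfattoGiulianiMastropietro2006];
FST 1996 §1 [cite: FeldmanSalmhoferTrubowitz1996].
-/

noncomputable section

namespace Summit.HubbardSuperconductivity.HubbardSuperconductivity.Theorems.EngineV8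

set_option linter.dupNamespace false -- summit = problem name (single-conjunct summit), D-0017
set_option exponentiation.threshold 512 -- the graded alias-tail constant is `2^282`

open Complex Real Finset Filter Literature.MathematicalPhysics.QuantumLattice Literature.Probability.LatticeModels
open Literature.MathematicalPhysics.QuantumLattice.BandSectorCounting
open Literature.Analysis.Fourier Literature.Analysis.Calculus
open Summit.HubbardSuperconductivity.HubbardSuperconductivity.Theorems.KLRegimeSplit
open Summit.HubbardSuperconductivity.HubbardSuperconductivity.Theorems.DispersionFlow
open Summit.HubbardSuperconductivity.HubbardSuperconductivity.Theorems.KLProgrammeLegKernels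
open Summit.HubbardSuperconductivity.HubbardSuperconductivity.Theorems.PerturbedFermiCurve
open scoped Nat

section LastOfDoorGraded

variable {L M : ℕ} [NeZero L] [NeZero M]

/-- **THE LAST-INDEX REGISTERED TWO-LEG PAIR FROM THE GRADED DOOR** — see the module docstring. -/
theorem twoLegRead_flow_last_registered_of_door_graded {R : RenConsts} (hR : ∀ j, 0 ≤ R.Gfr j) {c : ℝ} (hc : 0 < c) (hcle : c ≤ klCurveC3 R)
    {U : ℝ} (hU : 0 < U) (hU1 : U ≤ 1) (hUle : U ≤ klCurveU0 R) {β : ℝ} (hβmin : klBetaMin ≤ β) (hβc : β ≤ Real.exp (c / U ^ 2))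
    {μ : ℝ} (hμ : μ ∈ klWindowC) (hK : FrameOK R U (nScales β) μ (klFlowFrameU L M β U μ (nScales β))) {G : GeoConsts} {Q : EngConsts} (hGS : ∀ k, 0 ≤ G.S k) (hQS : ∀ k, 0 ≤ Q.S' k) (hR0 : 0 < R.Gfr 0)
    (hPh : ∀ m ≤ nScales β, FlowPieceJetsAt L M β U μ R m) (hT : ∀ m ≤ nScales β, TwoLegReadJetsF L M G Q β U μ m) {W Ξ Θ : ℝ}
    (hW : W = curveExtC (klChi2CauchyTab2 4) G.S 1 + curveExtC (klChi2CauchyTab2 4) Q.S' 1 * |U|) (hΞ : Ξ = 2 ^ 10 * (1 + Real.pi ^ 8 * (W * U ^ 2) / 2 ^ 11) + ∑ j ∈ range 5, R.Gfr j)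
    (hΘ : Θ = 1 + ((∑ j ∈ range 5, R.Gfr j) + Real.pi ^ 8 * W / 2 ^ 11) * |U| / R.Gfr 0)
    (hdoor : R.Gfr 0 * |U| + ((∑ j ∈ range 5, R.Gfr j) + Real.pi ^ 8 * W / 2 ^ 11) * U ^ 2 ≤ 1 / 512) {P : SplitConsts} (hL : klEngL₄ P R β U ≤ L)
    (hZn : IsUnit (effPartitionFn ℂ (normalCovariance L M (uvSymbolCT L M β μ (klFlowFrameU L M β U μ (nScales β + 1)) (klScale klE0 (nScales β + 1))))
      (hubbardInteraction L M β U + counterQuadratic L M β (klFlowFrameU L M β U μ (nScales β + 1)))))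
    {Zb Zc Nmb Nsb Nmc Nsc : ℝ} (hZtU : 2 * (128 * (R.Gfr 0 + R.Gfr 1 + R.Gfr 2 + R.Gfr 3 + R.Gfr 4) * (1696963596321 + 925 * (10 ^ 14 * (1 + R.Gfr 3 + R.Gfr 4)))) * U ≤ 1)
    (hCU : 16 * (2 ^ 29 * (1 / 32) * (128 * (R.Gfr 0 + R.Gfr 1 + R.Gfr 2 + R.Gfr 3 + R.Gfr 4) * (1696963596321 + 925 * (10 ^ 14 * (1 + R.Gfr 3 + R.Gfr 4)))) ^ 3 * (1696963596321 +
      925 * (10 ^ 14 * (1 + R.Gfr 3 + R.Gfr 4))) + 2 ^ 38 * (128 * (R.Gfr 0 + R.Gfr 1 + R.Gfr 2 + R.Gfr 3 + R.Gfr 4) * (1696963596321 + 925 * (10 ^ 14 * (1 + R.Gfr 3 + R.Gfr 4)))) ^ 2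
      * Zb + 2 ^ 33 * (128 * (R.Gfr 0 + R.Gfr 1 + R.Gfr 2 + R.Gfr 3 + R.Gfr 4) * (1696963596321 + 925 * (10 ^ 14 * (1 + R.Gfr 3 + R.Gfr 4)))) * Zc + (klEngRsq R ^ 4 * (1696963596321 +
      925 * (10 ^ 14 * (1 + R.Gfr 3 + R.Gfr 4))) / 2 ^ 30 + (Nmb * klEngRsq R ^ 4 / 2 ^ 6 + Nsb / 2 ^ 282) * (1696963596321 + 925 * (10 ^ 14 * (1 + R.Gfr 3 + R.Gfr 4))) / 2 ^ 13 + (Nmc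
      * klEngRsq R ^ 4 / 2 ^ 6 + Nsc / 2 ^ 282) * (1696963596321 + 925 * (10 ^ 14 * (1 + R.Gfr 3 + R.Gfr 4))) / 2 ^ 13)) * U ≤ 1)
    {s : ℕ} (hs : 10 ≤ s)
    {Mmb : ℕ → ℝ} (hMmb : ∀ m ≤ 4, ∑ x : TorusSite 2 L, (1 + ((x 0).valMinAbs.natAbs : ℝ) + ((x 1).valMinAbs.natAbs : ℝ)) ^ m *
      ‖torusFourierInv (fun k => ((((fun k : TorusSite 2 L => klLocSelfEnergyRe L M β U μ (klFlowFrameU L M β U μ (nScales β + 1)) (nScales β + 1) k) k : ℝ)) : ℂ)) x‖ ≤ Mmb m)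
    {Msb : ℝ} (hMsb : ∑ x : TorusSite 2 L, (1 + ((x 0).valMinAbs.natAbs : ℝ) + ((x 1).valMinAbs.natAbs : ℝ)) ^ s *
      ‖torusFourierInv (fun k => ((((fun k : TorusSite 2 L => klLocSelfEnergyRe L M β U μ (klFlowFrameU L M β U μ (nScales β + 1)) (nScales β + 1) k) k : ℝ)) : ℂ)) x‖ ≤ Msb)
    {Mmc : ℕ → ℝ} (hMmc : ∀ m ≤ 4, ∑ x : TorusSite 2 L, (1 + ((x 0).valMinAbs.natAbs : ℝ) + ((x 1).valMinAbs.natAbs : ℝ)) ^ m *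
      ‖torusFourierInv (fun k => ((((fun k : TorusSite 2 L => (∑ s : Fin 2, ((klSelfEnergy L M β U μ (klFlowFrameU L M β U μ (nScales β + 1)) klE0 (nScales β + 1) (omega0 M, k) s).im -
          (klSelfEnergy L M β U μ (klFlowFrameU L M β U μ (nScales β + 1)) klE0 (nScales β + 1) ((omega0 M).rev, k) s).im)) / 4) k : ℝ)) : ℂ)) x‖ ≤ Mmc m)
    {Msc : ℝ} (hMsc : ∑ x : TorusSite 2 L, (1 + ((x 0).valMinAbs.natAbs : ℝ) + ((x 1).valMinAbs.natAbs : ℝ)) ^ s *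
      ‖torusFourierInv (fun k => ((((fun k : TorusSite 2 L => (∑ s : Fin 2, ((klSelfEnergy L M β U μ (klFlowFrameU L M β U μ (nScales β + 1)) klE0 (nScales β + 1) (omega0 M, k) s).im -
          (klSelfEnergy L M β U μ (klFlowFrameU L M β U μ (nScales β + 1)) klE0 (nScales β + 1) ((omega0 M).rev, k) s).im)) / 4) k : ℝ)) : ℂ)) x‖ ≤ Msc)
    (hZb : Nmb * (1696963596321 + 925 * (10 ^ 14 * (1 + R.Gfr 3 + R.Gfr 4))) ≤ Zb * U) (hZc : Nmc * (1696963596321 + 925 * (10 ^ 14 * (1 + R.Gfr 3 + R.Gfr 4))) * (4 : ℝ) ^ nScales β ≤ Zc * U ^ 2)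
    (hNmb : ∀ j ≤ 4, Mmb j ≤ Nmb * ((4 : ℝ) ^ nScales β) ^ j) (hNsb : Msb ≤ Nsb * ((4 : ℝ) ^ nScales β) ^ s) (hNmc : ∀ j ≤ 4, Mmc j ≤ Nmc * ((4 : ℝ) ^ nScales β) ^ j) (hNsc : Msc ≤ Nsc * ((4 : ℝ) ^ nScales β) ^ s)
    -- the (P)-receiver's other inputs at the last index (k3c3-p1 `twoLegRead_flow_succ_of_swap_lit_registered`, n := n_β)
    (hLdeg : 4 * klFlowDeg (nScales β + 1) ≤ L) {cA cA' eT eT' eJ eJ' : ℕ → ℝ} {τA a : ℝ}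
    (hA : TwoLegCurveJetBound L M cA cA' β U μ (klFlowFrameU L M β U μ (nScales β)) (nScales β + 1))
    (hAval : ∀ θ : ℝ, |klTwoLegCurveProfile L M β U μ (klFlowFrameU L M β U μ (nScales β)) (nScales β + 1) θ - τA| ≤
      a * U ^ 2 * (4 : ℝ) ^ (-2 * ((nScales β + 1 : ℕ) : ℤ)))
    (hTrdiff : ContDiff ℝ 4 fun θ : ℝ =>
      ((symInterp L (klLocSelfEnergyRe L M β U μ (klFlowFrameU L M β U μ (nScales β + 1)) (nScales β + 1))).eval
            (klFermiPoint μ (klFlowFrameU L M β U μ (nScales β + 1)) θ) +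
          (klFlowPiece L M β U μ (nScales β)).eval (klFermiPoint μ (klFlowFrameU L M β U μ (nScales β + 1)) θ)) -
        ((symInterp L (klLocSelfEnergyRe L M β U μ (klFlowFrameU L M β U μ (nScales β + 1)) (nScales β + 1))).eval
            (klFermiPoint μ (klFlowFrameU L M β U μ (nScales β)) θ) +
          (klFlowPiece L M β U μ (nScales β)).eval (klFermiPoint μ (klFlowFrameU L M β U μ (nScales β)) θ)))
    (hTr : ∀ k ≤ 4, ∀ θ : ℝ, |iteratedDeriv k (fun θ : ℝ =>
      ((symInterp L (klLocSelfEnergyRe L M β U μ (klFlowFrameU L M β U μ (nScales β + 1)) (nScales β + 1))).eval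
            (klFermiPoint μ (klFlowFrameU L M β U μ (nScales β + 1)) θ) +
          (klFlowPiece L M β U μ (nScales β)).eval (klFermiPoint μ (klFlowFrameU L M β U μ (nScales β + 1)) θ)) -
        ((symInterp L (klLocSelfEnergyRe L M β U μ (klFlowFrameU L M β U μ (nScales β + 1)) (nScales β + 1))).eval
            (klFermiPoint μ (klFlowFrameU L M β U μ (nScales β)) θ) +
          (klFlowPiece L M β U μ (nScales β)).eval (klFermiPoint μ (klFlowFrameU L M β U μ (nScales β)) θ))) θ| ≤ curveJetBar eT eT' U k (nScales β + 1))
    (hJdiff : ContDiff ℝ 4 fun θ : ℝ => klLocalPart L M β U μ (klFlowFrameU L M β U μ (nScales β)) (nScales β) θ -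
      (klFlowPiece L M β U μ (nScales β)).eval (klFermiPoint μ (klFlowFrameU L M β U μ (nScales β + 1)) θ))
    (hJ : ∀ k ≤ 4, ∀ θ : ℝ, |iteratedDeriv k (fun θ : ℝ => klLocalPart L M β U μ (klFlowFrameU L M β U μ (nScales β)) (nScales β) θ -
      (klFlowPiece L M β U μ (nScales β)).eval (klFermiPoint μ (klFlowFrameU L M β U μ (nScales β + 1)) θ)) θ| ≤ curveJetBar eJ eJ' U k (nScales β + 1))
    (heT0 : eT 0 = 0) (heJ0 : eJ 0 = 0)
    (hfit : ∀ k, cA k + ((if k = 0 then (0 : ℝ) else 1) + eT k + eJ k) ≤ klC4aJetC2 k)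
    (hfit' : ∀ k, cA' k + ((if k = 0 then (1 : ℝ) else 0) + eT' k + eJ' k) ≤ klC4aJetC' P R k)
    (hfitO : 2 * (a + (1 + eT' 0 + eJ' 0)) ≤ klReadOscC P R) :
    TwoLegReadJetBound L M klC4aJetC2 (klC4aJetC' P R) β U μ (klFlowFrameU L M β U μ (nScales β + 1)) (nScales β + 1) ∧
      TwoLegReadOscAt L M (klReadOscC P R) β U μ (klFlowFrameU L M β U μ (nScales β + 1)) (nScales β + 1) := by
  obtain ⟨hRdiff, hRrows⟩ := lastResponse_bracket_flow_final_graded hR hc hcle hU hU1 hUle hβmin hβc hμ hK hGS hQS hR0 hPh hT hW hΞ hΘ hdoor hL hZn hZtU hCU hs hMmb hMsb hMmc hMsc hZb hZc hNmb hNsb hNmc hNsc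
  have e1 : (fun k : ℕ => if k = 0 then (1 : ℝ) else 0) 0 = 1 := if_pos rfl
  have hfitO' : 2 * (a + ((fun k : ℕ => if k = 0 then (1 : ℝ) else 0) 0 + eT' 0 + eJ' 0)) ≤ klReadOscC P R := by rw [e1]; exact hfitO
  exact twoLegRead_flow_succ_of_swap_lit_registered β U μ hLdeg hA hAval hRdiff hRrows hTrdiff hTr hJdiff hJ (if_pos rfl) heT0 heJ0
    (fun k => hfit k) (fun k => hfit' k) hfitO'

end LastOfDoorGraded

end Summit.HubbardSuperconductivity.HubbardSuperconductivity.Theorems.EngineV8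

end
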